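import Summits.QuantumAdvantage.QuantumAdvantage.Theorems.LinnikCubicClassGroupsDegreeOnePrimesEscapeFrobeniusLeastPrime
import HarnessLib

/-!
# Counting lemmas for the least degree-one prime with prescribed Frobenius (cyclic extensions)

Topic `Summits/QuantumAdvantage/QuantumAdvantage/Theorems`, cell B2b-1 (linnik-cubic), PART A (gen 12); helper
toward the crux `DegreeOnePrimesEscape` (stmt-QuantumAdvantage-11543) — the E-side input for the descent of the
Lagarias–Montgomery–Odlyzko programme to conjugacy classes.  HONEST FRAMING: the value of this file is a THEOREM
(kernel-checked, GRH-free) — NOT summit progress.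

This file: the counting lemmas (`sum_log_absNorm_not_prime_le` — primes of degree `≥ 2`;
`sum_log_absNorm_prime_dvd_le` — degree-one primes above `d_N`; `psiWeighted_le_of_forall_degOne` — from prime
powers to good primes).  The theorem itself is in `…FrobeniusLeastDegOnePrime.lean`:
**Theorem** (`exists_degOnePrime_galFrob_eq_absNorm_le`, there).  For `n > 1` there is `L = L(n) > 0` such that for every
cyclic extension `N|E` of number fields with `[N:ℚ] = n`, `1 < [E:ℚ]`, and every `τ ∈ Gal(N|E)`, there is a prime
`𝔭` of `E`, unramified in `N`, with `Frob_𝔭 = τ`, `N𝔭 = p` a rational PRIME with `p ∤ d_N`, and `p ≤ Q^{L}`,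
`Q = |d_N| nⁿ`.  (A degree-one `𝔭` over an unramified `p` with `Frob_{N|E}(𝔭) = τ` is exactly what makes `τ` the
Frobenius of a prime of `N` over `p` in `Gal(N|ℚ)` when `N|ℚ` is Galois and `E = N^{⟨τ⟩}`.)
[Weiss1983, Theorem 6.1]; [LagariasMontgomeryOdlyzko1979, Theorem 1.1 and §3].

Proof: as `exists_prime_galFrob_eq_absNorm_le`, discarding in addition the primes `𝔭` with `N𝔭 = p^f`, `f ≥ 2`
(`≤ [E:ℚ](√x + 1)` of them, each `≤ log x`) and those with `N𝔭 = p ∣ d_N` (`≤ [E:ℚ] ω(d_N)` of them, each `≤ log|d_N|`).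
-/

noncomputable section

open Complex Real Finset NumberField IsDedekindDomain
open scoped NumberField nonZeroDivisors Classical

namespace Summit.QuantumAdvantage.QuantumAdvantage.Theorems.DegreeOnePrimesEscape

open Literature.NumberTheory.LFunctions Literature.NumberTheory.LFunctions.NumberField
  Literature.NumberTheory.LFunctions.EntireEF Literature.NumberTheory.LFunctions.TZWeight
  Literature.NumberTheory.LFunctions.AbelianDensity Literature.NumberTheory.GaloisRepresentations

variable {E N : Type} [Field E] [NumberField E] [Field N] [NumberField N] [Algebra E N] [IsGalois E N]

/-! ### Counting primes of `E` above rational primes -/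

omit [NumberField E] in
/-- A prime `P ∋ p` of `𝓞 E` lies in `primesOverFinset (p)`. -/
theorem mem_primesOverFinset_of_natCast_mem [NumberField E] {P : Ideal (𝓞 E)} (hP : P.IsPrime)
    {p : ℕ} (hp : p.Prime) (hpP : (p : 𝓞 E) ∈ P) :
    P ∈ IsDedekindDomain.primesOverFinset (Ideal.span {(p : ℤ)}) (𝓞 E) := by
  haveI := Fact.mk hp
  have hp0 : Ideal.span {(p : ℤ)} ≠ ⊥ := by simp [hp.ne_zero]
  rw [IsDedekindDomain.mem_primesOverFinset_iff hp0]
  refine ⟨hP, ⟨?_⟩⟩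
  refine (Ideal.IsMaximal.eq_of_le inferInstance (Ideal.IsPrime.under ℤ P).ne_top ?_)
  rw [Ideal.span_le, Set.singleton_subset_iff, SetLike.mem_coe, Ideal.under_def, Ideal.mem_comap, map_natCast]
  exact hpP

/-- **Primes of degree `≥ 2`**: `Σ_{N𝔭 ≤ x, N𝔭 not prime} log N𝔭 ≤ [E:ℚ](√x + 1) log x` for `x ≥ 1`. -/
theorem sum_log_absNorm_not_prime_le {x : ℝ} (hx : 1 ≤ x) :
    ∑ P ∈ (finite_primeIdealsLE E x).toFinset with ¬ (Ideal.absNorm P).Prime, Real.log (Ideal.absNorm P : ℝ) ≤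
      Module.finrank ℚ E * (Real.sqrt x + 1) * Real.log x := by
  set T := (finite_primeIdealsLE E x).toFinset.filter (fun P ↦ ¬ (Ideal.absNorm P).Prime) with hT
  have hlogx : 0 ≤ Real.log x := Real.log_nonneg hx
  -- `T ⊆ ⋃_{p ≤ √x prime} primesOverFinset (p)`
  set I : Finset ℕ := (Finset.range (⌊Real.sqrt x⌋₊ + 1)).filter Nat.Prime with hI
  have hsub : T ⊆ I.biUnion (fun p ↦ IsDedekindDomain.primesOverFinset (Ideal.span {(p : ℤ)}) (𝓞 E)) := by
    intro P hP
    rw [hT, Finset.mem_filter, Set.Finite.mem_toFinset] at hP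
    obtain ⟨⟨hprime, hP0, hle⟩, hnp⟩ := hP
    haveI : P.IsMaximal := hprime.isMaximal hP0
    obtain ⟨p, k, hk, hpP, hp, hNP⟩ := Ideal.exists_prime_and_absNorm_eq_pow P
    have hk2 : 2 ≤ k := by
      by_contra h
      have : k = 1 := by omega
      rw [this, pow_one] at hNP
      exact hnp (hNP ▸ hp)
    have hp2x : ((p : ℝ)) ^ 2 ≤ x := by
      have h1 : (p : ℝ) ^ 2 ≤ (p : ℝ) ^ k := pow_le_pow_right₀ (by exact_mod_cast hp.one_lt.le) hk2
      have h2 : ((p ^ k : ℕ) : ℝ) ≤ x := by rw [← hNP]; exact hle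
      push_cast at h2; linarith
    rw [Finset.mem_biUnion]
    refine ⟨p, ?_, mem_primesOverFinset_of_natCast_mem hprime hp hpP⟩
    rw [hI, Finset.mem_filter, Finset.mem_range]
    refine ⟨Nat.lt_succ_of_le (Nat.le_floor ?_), hp⟩
    exact (Real.le_sqrt (Nat.cast_nonneg _) (by linarith)).mpr hp2x
  have hcard : (T.card : ℝ) ≤ Module.finrank ℚ E * (Real.sqrt x + 1) := by
    have h1 := Finset.card_le_card hsub
    have h2 := Finset.card_biUnion_le (s := I) (t := fun p ↦ IsDedekindDomain.primesOverFinset (Ideal.span {(p : ℤ)}) (𝓞 E))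
    have h3 : ∑ p ∈ I, (IsDedekindDomain.primesOverFinset (Ideal.span {(p : ℤ)}) (𝓞 E)).card ≤ ∑ p ∈ I, Module.finrank ℚ E := by
      refine Finset.sum_le_sum fun p hp ↦ ?_
      have hpp : p.Prime := (Finset.mem_filter.mp hp).2
      haveI := Fact.mk hpp
      exact Ideal.card_primesOverFinset_le_finrank (𝓞 E) ℚ E (by simp [hpp.ne_zero])
    rw [Finset.sum_const, smul_eq_mul] at h3
    have hI : I.card ≤ ⌊Real.sqrt x⌋₊ + 1 := (Finset.card_filter_le _ _).trans (by rw [Finset.card_range])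
    have h4 : T.card ≤ (⌊Real.sqrt x⌋₊ + 1) * Module.finrank ℚ E := h1.trans (h2.trans (h3.trans (Nat.mul_le_mul_right _ hI)))
    have h5 : (T.card : ℝ) ≤ ((⌊Real.sqrt x⌋₊ : ℝ) + 1) * Module.finrank ℚ E := by exact_mod_cast h4
    have h6 : (⌊Real.sqrt x⌋₊ : ℝ) ≤ Real.sqrt x := Nat.floor_le (Real.sqrt_nonneg x)
    have h7 : (0 : ℝ) ≤ Module.finrank ℚ E := Nat.cast_nonneg _
    nlinarith
  calc ∑ P ∈ T, Real.log (Ideal.absNorm P : ℝ) ≤ ∑ P ∈ T, Real.log x := by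
        refine Finset.sum_le_sum fun P hP ↦ ?_
        rw [hT, Finset.mem_filter, Set.Finite.mem_toFinset] at hP
        obtain ⟨⟨_, hP0, hle⟩, -⟩ := hP
        exact Real.log_le_log (by exact_mod_cast Nat.pos_of_ne_zero (by rw [ne_eq, Ideal.absNorm_eq_zero_iff]; exact hP0)) hle
    _ = T.card * Real.log x := by rw [Finset.sum_const, nsmul_eq_mul]
    _ ≤ Module.finrank ℚ E * (Real.sqrt x + 1) * Real.log x := mul_le_mul_of_nonneg_right hcard hlogx

omit [Algebra E N] [IsGalois E N] in
/-- **Degree-one primes above `d_N`**: `Σ_{N𝔭 = p prime, p ∣ d_N, N𝔭 ≤ x} log N𝔭 ≤ [E:ℚ] ω(d_N) log|d_N|`. -/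
theorem sum_log_absNorm_prime_dvd_le (x : ℝ) :
    ∑ P ∈ (finite_primeIdealsLE E x).toFinset with ((Ideal.absNorm P).Prime ∧ ((Ideal.absNorm P : ℤ) ∣ NumberField.discr N)),
        Real.log (Ideal.absNorm P : ℝ) ≤
      Module.finrank ℚ E * ((NumberField.discr N).natAbs.primeFactors.card) *
        Real.log ((NumberField.discr N).natAbs : ℝ) := by
  set d : ℕ := (NumberField.discr N).natAbs with hd
  have hd0 : d ≠ 0 := Int.natAbs_ne_zero.mpr (NumberField.discr_ne_zero N)
  set T := (finite_primeIdealsLE E x).toFinset.filter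
    (fun P ↦ (Ideal.absNorm P).Prime ∧ ((Ideal.absNorm P : ℤ) ∣ NumberField.discr N)) with hT
  have hmemT : ∀ P ∈ T, P.IsPrime ∧ P ≠ ⊥ ∧ (Ideal.absNorm P).Prime ∧ Ideal.absNorm P ∈ d.primeFactors := by
    intro P hP
    rw [hT, Finset.mem_filter, Set.Finite.mem_toFinset] at hP
    obtain ⟨⟨hprime, hP0, -⟩, hp, hdvd⟩ := hP
    refine ⟨hprime, hP0, hp, ?_⟩
    rw [Nat.mem_primeFactors]
    refine ⟨hp, ?_, hd0⟩
    have := Int.natAbs_dvd_natAbs.mpr hdvd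
    rwa [Int.natAbs_natCast] at this
  have hsub : T ⊆ d.primeFactors.biUnion (fun p ↦ IsDedekindDomain.primesOverFinset (Ideal.span {(p : ℤ)}) (𝓞 E)) := by
    intro P hP
    obtain ⟨hprime, hP0, hp, hmem⟩ := hmemT P hP
    rw [Finset.mem_biUnion]
    exact ⟨Ideal.absNorm P, hmem, mem_primesOverFinset_of_natCast_mem hprime hp (Ideal.absNorm_mem P)⟩
  have hcard : (T.card : ℝ) ≤ Module.finrank ℚ E * (d.primeFactors.card : ℝ) := by
    have h1 := Finset.card_le_card hsub
    have h2 := Finset.card_biUnion_le (s := d.primeFactors)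
      (t := fun p ↦ IsDedekindDomain.primesOverFinset (Ideal.span {(p : ℤ)}) (𝓞 E))
    have h3 : ∑ p ∈ d.primeFactors, (IsDedekindDomain.primesOverFinset (Ideal.span {(p : ℤ)}) (𝓞 E)).card ≤
        ∑ p ∈ d.primeFactors, Module.finrank ℚ E := by
      refine Finset.sum_le_sum fun p hp ↦ ?_
      have hpp : p.Prime := Nat.prime_of_mem_primeFactors hp
      haveI := Fact.mk hpp
      exact Ideal.card_primesOverFinset_le_finrank (𝓞 E) ℚ E (by simp [hpp.ne_zero])
    rw [Finset.sum_const, smul_eq_mul] at h3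
    have : T.card ≤ d.primeFactors.card * Module.finrank ℚ E := h1.trans (h2.trans h3)
    have : (T.card : ℝ) ≤ (d.primeFactors.card : ℝ) * Module.finrank ℚ E := by exact_mod_cast this
    linarith
  have hlogd : 0 ≤ Real.log (d : ℝ) := Real.log_natCast_nonneg _
  calc ∑ P ∈ T, Real.log (Ideal.absNorm P : ℝ) ≤ ∑ P ∈ T, Real.log (d : ℝ) := by
        refine Finset.sum_le_sum fun P hP ↦ ?_
        obtain ⟨-, -, hp, hmem⟩ := hmemT P hP
        exact Real.log_le_log (by exact_mod_cast hp.pos) (by exact_mod_cast Nat.le_of_mem_primeFactors hmem)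
    _ = T.card * Real.log (d : ℝ) := by rw [Finset.sum_const, nsmul_eq_mul]
    _ ≤ Module.finrank ℚ E * (d.primeFactors.card : ℝ) * Real.log (d : ℝ) := mul_le_mul_of_nonneg_right hcard hlogd

/-! ### From prime powers to good primes -/

/-- If no prime `𝔭` of `E` with `N𝔭 = p ≤ x` prime, `p ∤ d_N`, unramified in `N` with `Frob_𝔭 = τ` exists, then
`ψ_τ(x) ≤ (ψ_E − θ_E)(x) + Σ_{N𝔭 ≤ x not prime} log N𝔭 + Σ_{N𝔭 = p ∣ d_N, N𝔭 ≤ x} log N𝔭`. -/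
theorem psiWeighted_le_of_forall_degOne (τ : N ≃ₐ[E] N) {wτ : Ideal (𝓞 E) → ℝ}
    (hwτ : ∀ I, wτ I = if (∃ v : HeightOneSpectrum (𝓞 E), Algebra.IsUnramifiedIn (𝓞 N) v.asIdeal ∧
      ∃ k : ℕ, I = v.asIdeal ^ k ∧ galFrob E N v ^ k = τ) then 1 else 0)
    {x : ℝ} (hx : 0 ≤ x)
    (hno : ∀ v : HeightOneSpectrum (𝓞 E), Algebra.IsUnramifiedIn (𝓞 N) v.asIdeal → galFrob E N v = τ →
      (Ideal.absNorm v.asIdeal).Prime → ¬ ((Ideal.absNorm v.asIdeal : ℤ) ∣ NumberField.discr N) →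
      x < (Ideal.absNorm v.asIdeal : ℝ)) :
    (∑ n ∈ Icc 0 ⌊x⌋₊, ∑ I ∈ idealsOfNorm E n, wτ I * idealVonMangoldt I) ≤
      (chebyshevPsiIdeal E x - chebyshevThetaIdeal E x) +
      ∑ P ∈ (finite_primeIdealsLE E x).toFinset with ¬ (Ideal.absNorm P).Prime, Real.log (Ideal.absNorm P : ℝ) +
      ∑ P ∈ (finite_primeIdealsLE E x).toFinset with ((Ideal.absNorm P).Prime ∧ ((Ideal.absNorm P : ℤ) ∣ NumberField.discr N)),
        Real.log (Ideal.absNorm P : ℝ) := by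
  classical
  rw [chebyshevPsiIdeal_eq_sum_vonMangoldtNorm, chebyshevThetaIdeal_eq_sum_primeIdealsLE E hx]
  set S := (finite_primeIdealsLE E x).toFinset with hS
  set U := (Icc 0 ⌊x⌋₊).biUnion (idealsOfNorm E) with hU
  have hdisj : Set.PairwiseDisjoint (↑(Icc 0 ⌊x⌋₊) : Set ℕ) (idealsOfNorm E) := by
    intro m _ n _ hmn
    rw [Function.onFun, Finset.disjoint_left]
    intro I hIm hIn
    rw [mem_idealsOfNorm] at hIm hIn
    exact hmn (hIm.symm.trans hIn)
  have hsub : S ⊆ U := by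
    intro P hP
    rw [hS, Set.Finite.mem_toFinset] at hP
    obtain ⟨-, -, hle⟩ := hP
    rw [hU, Finset.mem_biUnion]
    exact ⟨Ideal.absNorm P, mem_Icc.mpr ⟨Nat.zero_le _, Nat.le_floor hle⟩, by rw [mem_idealsOfNorm]⟩
  have hΛS : ∀ P ∈ S, idealVonMangoldt P = Real.log (Ideal.absNorm P : ℝ) := by
    intro P hP
    rw [hS, Set.Finite.mem_toFinset] at hP
    obtain ⟨hprime, hP0, -⟩ := hP
    have := idealVonMangoldt_prime_pow (Ideal.prime_of_isPrime hP0 hprime) one_ne_zero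
    rwa [pow_one] at this
  unfold vonMangoldtNorm
  rw [← Finset.sum_biUnion hdisj, ← Finset.sum_biUnion hdisj]
  -- move the three sums over `S` to sums over `U` with indicators
  have hθ : ∑ P ∈ S, Real.log (Ideal.absNorm P : ℝ) = ∑ I ∈ U, if I ∈ S then idealVonMangoldt I else 0 := by
    rw [← Finset.sum_filter, Finset.filter_mem_eq_inter, Finset.inter_eq_right.mpr hsub]
    exact Finset.sum_congr rfl fun P hP ↦ (hΛS P hP).symm
  have hA : ∑ P ∈ S with ¬ (Ideal.absNorm P).Prime, Real.log (Ideal.absNorm P : ℝ) =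
      ∑ I ∈ U, if (I ∈ S ∧ ¬ (Ideal.absNorm I).Prime) then idealVonMangoldt I else 0 := by
    rw [← Finset.sum_filter]
    have : U.filter (fun I ↦ I ∈ S ∧ ¬ (Ideal.absNorm I).Prime) = S.filter (fun P ↦ ¬ (Ideal.absNorm P).Prime) := by
      ext I; simp only [Finset.mem_filter]
      exact ⟨fun h ↦ ⟨h.2.1, h.2.2⟩, fun h ↦ ⟨hsub h.1, h.1, h.2⟩⟩
    rw [this]
    exact Finset.sum_congr rfl fun P hP ↦ (hΛS P (Finset.mem_filter.mp hP).1).symm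
  have hB : ∑ P ∈ S with ((Ideal.absNorm P).Prime ∧ ((Ideal.absNorm P : ℤ) ∣ NumberField.discr N)),
        Real.log (Ideal.absNorm P : ℝ) =
      ∑ I ∈ U, if (I ∈ S ∧ (Ideal.absNorm I).Prime ∧ ((Ideal.absNorm I : ℤ) ∣ NumberField.discr N))
        then idealVonMangoldt I else 0 := by
    rw [← Finset.sum_filter]
    have : U.filter (fun I ↦ I ∈ S ∧ (Ideal.absNorm I).Prime ∧ ((Ideal.absNorm I : ℤ) ∣ NumberField.discr N)) =
        S.filter (fun P ↦ (Ideal.absNorm P).Prime ∧ ((Ideal.absNorm P : ℤ) ∣ NumberField.discr N)) := by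
      ext I; simp only [Finset.mem_filter]
      exact ⟨fun h ↦ ⟨h.2.1, h.2.2⟩, fun h ↦ ⟨hsub h.1, h.1, h.2⟩⟩
    rw [this]
    exact Finset.sum_congr rfl fun P hP ↦ (hΛS P (Finset.mem_filter.mp hP).1).symm
  rw [hθ, hA, hB, ← Finset.sum_sub_distrib, ← Finset.sum_add_distrib, ← Finset.sum_add_distrib]
  refine Finset.sum_le_sum fun I hI ↦ ?_
  have hΛ := idealVonMangoldt_nonneg I
  have hw1 : wτ I ≤ 1 := by rw [hwτ I]; split_ifs <;> norm_num
  have hw0 : 0 ≤ wτ I := by rw [hwτ I]; split_ifs <;> norm_num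
  by_cases hIS : I ∈ S
  · -- `I` is a prime of norm `≤ x`
    by_cases hw : (∃ v : HeightOneSpectrum (𝓞 E), Algebra.IsUnramifiedIn (𝓞 N) v.asIdeal ∧
        ∃ k : ℕ, I = v.asIdeal ^ k ∧ galFrob E N v ^ k = τ)
    · have hw' := hw
      obtain ⟨v, hunr, k, hIk, hk⟩ := hw'
      have hS' := hIS
      rw [hS, Set.Finite.mem_toFinset] at hS'
      obtain ⟨hprime, hI0, hle⟩ := hS'
      have hk1 : k = 1 :=
        ((heightOneSpectrum_pow_eq_pow (v := ⟨I, hprime, hI0⟩) (v' := v) (m := 1) (k := k) one_pos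
          (by rw [pow_one]; exact hIk)).2).symm
      rw [hk1, pow_one] at hk hIk
      -- `I = v` is not a good prime: either not of prime norm, or of prime norm dividing `d_N`
      have hbad : ¬ (Ideal.absNorm I).Prime ∨ ((Ideal.absNorm I).Prime ∧ ((Ideal.absNorm I : ℤ) ∣ NumberField.discr N)) := by
        by_cases hp : (Ideal.absNorm I).Prime
        · right; refine ⟨hp, ?_⟩
          by_contra hnd
          have := hno v hunr hk (by rw [← hIk]; exact hp) (by rw [← hIk]; exact hnd)
          rw [← hIk] at this
          linarith
        · left; exact hp
      rw [hwτ I, if_pos hw, one_mul, if_pos hIS]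
      rcases hbad with hnp | ⟨hp, hdvd⟩
      · rw [if_pos (show I ∈ S ∧ ¬ (Ideal.absNorm I).Prime from ⟨hIS, hnp⟩),
          if_neg (show ¬ (I ∈ S ∧ (Ideal.absNorm I).Prime ∧ ((Ideal.absNorm I : ℤ) ∣ NumberField.discr N)) from
            fun h ↦ hnp h.2.1)]
        linarith
      · rw [if_neg (show ¬ (I ∈ S ∧ ¬ (Ideal.absNorm I).Prime) from fun h ↦ h.2 hp),
          if_pos (show I ∈ S ∧ (Ideal.absNorm I).Prime ∧ ((Ideal.absNorm I : ℤ) ∣ NumberField.discr N) from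
            ⟨hIS, hp, hdvd⟩)]
        linarith
    · rw [hwτ I, if_neg hw, zero_mul]
      split_ifs <;> linarith
  · rw [if_neg hIS]
    have h1 : ¬ (I ∈ S ∧ ¬ (Ideal.absNorm I).Prime) := fun h ↦ hIS h.1
    have h2 : ¬ (I ∈ S ∧ (Ideal.absNorm I).Prime ∧ ((Ideal.absNorm I : ℤ) ∣ NumberField.discr N)) := fun h ↦ hIS h.1
    rw [if_neg h1, if_neg h2]
    nlinarith

end Summit.QuantumAdvantage.QuantumAdvantage.Theorems.DegreeOnePrimesEscape
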